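import Literature.MathematicalPhysics.KineticTheory.TaggedLinearBoltzmannSeries
import HarnessLib

/-!
# BGSR Theorem 2.2 in its uniform-rate form: the assembly from the pruned comparison
(Bodineau–Gallagher–Saint-Raymond, Invent. Math. 203 (2016) 493–553 = arXiv:1305.3397v2, proof
of Theorem 2.2, p. 21 of the held text `lit read arxiv:1305.3397`, chunk p0021; trunk T-KINETIC,
topic MathematicalPhysics/KineticTheory; the top layer of the bottom-up proof of the named fact
`Literature.MathematicalPhysics.KineticTheory.bgsr_linearBoltzmannApprox` of
`TaggedSphereDiffusion` — BGSR Thm 2.2 (2.9) with constants `C, N₀` depending on `d, β, A` and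
the bound `R ≥ ‖ρ⁰‖_∞` only.)

BGSR prove Theorem 2.2 (p. 21, "Proof of Theorem 2.2") in two displayed lines: *"Propositions
4.3 and 5.8 imply that with the scaling (5.1)
`‖f_N^{(1)} - g_α‖_{L^∞([0,t] × T^d × ℝ^d)} ≤ C (γ^A + C₀ ε^{(d-1)/(d+1)} exp(C (log N)^{1/2}
log log N)) ‖ρ⁰‖_{L^∞} ≤ C ((αt)^{A/(A-1)} / log log N)^A ‖ρ⁰‖_{L^∞}`, where we have used the
relation `γ = (αt)^{A/(A-1)}/(CK)` of (4.13) with the choice `K = ⌊log log N / (2 log A)⌋`. …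
Note that the relevant scaling for this upper bound is `αt = o((log log N)^{(A-1)/A})`."* The
first inequality is the *pruned comparison*: the pruning estimate of Prop. 4.3 for both
hierarchies (printed step condition (4.13): `h ≤ cγ/(α^{A/(A-1)} t^{1/(A-1)})`, i.e.
`(αt)^{A/(A-1)} ≤ c γ K` for `K = t/h` blocks; the tree's
`HierarchyModel.IsMildSolution.abs_sub_blockComp_le` of `HierarchyPruningEstimates` needs only
`C₀ c_R h ≤ γ/e²` with `c_R ∝ α`, i.e. `αt ≤ κ₁ γ K` — on the Boltzmann side this is
`abs_bgsrHierarchyFamily_sub_blockComp_le_torus` of `TaggedBoltzmannPruning`) plus the term-by-term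
comparison of the two pruned expansions, Prop. 5.8 (regime `αt ≪ (log log N)^{(A-1)/A}`,
`K ≤ log log N/(2 log A)`). The second inequality, together with everything the printed proof
leaves implicit — the integrality of `K`, the admissibility of `γ ≤ γ₀`, the largeness of `N`
*uniformly* in `α`, `t`, `ρ⁰`, and the complementary regime `αt ≳ (log log N)^{(A-1)/A}` in
which (2.9) is only true because its right-hand side dominates the trivial bound
`‖f_N^{(1)}‖_∞ + ‖M_β φ_α‖_∞ ≤ 2 ‖ρ⁰‖_∞ (β/2π)^{d/2}` (Prop. 4.1 and Remark 3.5) — is the content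
of this file, which PROVES

* `bgsr_linearBoltzmannApprox_of_prunedComparison`: **the pruned comparison implies
  `bgsr_linearBoltzmannApprox`**, i.e. BGSR Thm 2.2 in the uniform form vendored in
  `TaggedSphereDiffusion` (constants depending on `d, β, A, R` only; `t > 1`, `α > 1`);
* `bgsr_linearBoltzmannApprox_of_prunedComparison_pow`: the same with the `ε`-term of the
  comparison carrying any exponent `(d-1)/(q+1)`, `q ∈ ℕ`, instead of `(d-1)/(d+1)` (the form the
  §5 estimates deliver with the honest post-collisional recollision rate of
  `GoodConfigurationsMeasure`; the tuning of p. 21 absorbs any positive power of `ε`).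

The hypothesis is stated inline (no new named fact, D-0026) in the form the tree's layers
deliver it: there are `κ₁, c₁, c₂ > 0`, `C₁` and `N₁` (depending on `d, β, A, R`) such that for
`N ≥ N₁`, `0 < ε < 1/2`, `α := (N+1) ε^{d-1} > 1`, a continuous probability density
`0 ≤ ρ⁰ ≤ R`, any hard-sphere flow, `t > 1`, any number of blocks `1 ≤ K ≤ c₂ log log (N+1)`,
any `0 < γ ≤ 1/2` with the step conditions `tα ≤ κ₁ γ K` (tree form) and
`(tα)^{A/(A-1)} ≤ κ₁ γ K` (printed form (4.13), which implies the former as `tα > 1`) and the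
regime condition `tα ≤ c₁ (log log (N+1))^{(A-1)/A}`, almost everywhere
`|f_N^{(1)}(t) - M_β φ_α(t)| ≤ C₁ (γ^A + ε^{(d-1)/(d+1)} exp(C₁ √(log (N+1)) log log (N+1)))`,
`φ_α` being the collision-series solution of (1.3) (`linearBoltzmannSeries`, the unique solution in
the class `IsTaggedLinearBoltzmannSolution`, `TaggedLinearBoltzmannSeries`). What then remains of
`bgsr_linearBoltzmannApprox` is exactly this printed intermediate display, i.e. Prop. 4.3 on the
BBGKY side (the hard-sphere marginals as a two-time mild solution of `bbgkyModel`, not yet in the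
tree) and Prop. 5.8 (BGSR §5, not yet in the tree).

## The proof

Given the constants of the hypothesis, put `c := min(c₁, 1, κ₁ c₂/4)`, `L := log log (N+1)`,
`ℓ := log (N+1)`, and take `N₀ ≥ N₁` so large that `L ≥ max(1, 2/c₂)` and
`ℓ ≥ max(1, (4 (c₁ + A + C₁') (d+1))⁴)`, `C₁' = max(C₁, 1)`. For `t > 1`:

* if `tα ≤ c L^{(A-1)/A}` (*regime*): `K := ⌊c₂ L⌋ ≥ c₂ L/2 ≥ 1` and, as printed,
  `γ := (tα)^{A/(A-1)}/(κ₁ K)`; then `(tα)^{A/(A-1)} ≤ c^{A/(A-1)} L ≤ c L`, so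
  `γ ≤ 2c/(κ₁ c₂) ≤ 1/2` and both step conditions hold, and the hypothesis applies;
  `γ^A ≤ (2/(κ₁ c₂))^A (tα)^{A²/(A-1)} / L^A`, while `ε^{(d-1)/(d+1)} = (α/(N+1))^{1/(d+1)}` with
  `α ≤ c₁ L`, so that `ε^{(d-1)/(d+1)} e^{C₁' √ℓ L} L^A ≤ exp(c₁ L + C₁' √ℓ L + A L - ℓ/(d+1)) ≤ 1`
  by `L = log ℓ ≤ 4 ℓ^{1/4}` (`Real.log_le_rpow_div`) and `ℓ^{1/4} ≥ 4 (c₁ + A + C₁')(d+1)`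
  (`rate_epsTerm_mul_le_one`); altogether `≤ C₁' ((2/(κ₁c₂))^A + 1) (tα)^{A²/(A-1)}/L^A`, and
  `(tα)^{A²/(A-1)}/L^A = [tα / L^{(A-1)/A}]^{A²/(A-1)}` is the rate (2.9) (`rate_rpow_eq`);
* otherwise `[tα / L^{(A-1)/A}]^{A²/(A-1)} > c^{A²/(A-1)}` and the trivial bound
  `|f^{(1)} - M_β φ_α| ≤ 2 R (2π/β)^{-d/2}` (`abs_bgsrTaggedMarginal_sub_mul_le`) is at most
  `(2R(2π/β)^{-d/2} c^{-A²/(A-1)} + 1)` times the rate.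

The `L^∞` norm of (2.9) is the essential supremum (`eLpNormEssSup_le_of_ae_bound`).

## References

* T. Bodineau, I. Gallagher, L. Saint-Raymond, *The Brownian motion as the limit of a
  deterministic system of hard-spheres*, Invent. Math. 203 (2016) 493–553 = arXiv:1305.3397v2:
  Thm 2.2 (2.9) p. 7; Prop. 4.1, Prop. 4.3 (4.13)–(4.14) pp. 11–14; (5.1), Prop. 5.8
  (5.24)–(5.25) and the proof of Thm 2.2, pp. 15, 21; Remark 3.5 (chunks p0007, p0011–p0014,
  p0015, p0021 of the held text).
-/

open MeasureTheory Set Filter Real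
open scoped ENNReal Topology

namespace Literature.MathematicalPhysics.KineticTheory

noncomputable section

section Kinetic

open Literature.Analysis.FluidPDE Literature.Analysis.FunctionSpaces

variable {d : Type*} [Fintype d]

/-! ## Real-variable lemmas: the rate, the step count and the `ε`-term -/

section RealLemmas

/-- The algebra of the rate (2.9): `[a / L^{(A-1)/A}]^{A²/(A-1)} = a^{A²/(A-1)} / L^A` for
`a, L ≥ 0`, `A ≥ 2` (BGSR p. 21: `C ((αt)^{A/(A-1)}/log log N)^A` is (2.9)). [folklore] -/
theorem rate_rpow_eq {a L A : ℝ} (ha : 0 ≤ a) (hL : 0 ≤ L) (hA : 2 ≤ A) :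
    (a / L ^ ((A - 1) / A)) ^ (A ^ 2 / (A - 1)) = a ^ (A ^ 2 / (A - 1)) / L ^ A := by
  rw [div_rpow ha (rpow_nonneg hL _), ← rpow_mul hL]
  have hA0 : A ≠ 0 := by positivity
  have hA1 : A - 1 ≠ 0 := by
    intro h
    linarith
  congr 2
  field_simp

/-- The integer number of blocks: for `c L ≥ 2`, `K = ⌊c L⌋` satisfies `1 ≤ K ≤ c L` and
`K ≥ c L / 2` (BGSR p. 21: `K = ⌊log log N / (2 log A)⌋`). [folklore] -/
theorem one_le_floor_and_le {x : ℝ} (h2 : 2 ≤ x) :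
    1 ≤ ⌊x⌋₊ ∧ (⌊x⌋₊ : ℝ) ≤ x ∧ x / 2 ≤ ⌊x⌋₊ := by
  have h0 : 0 ≤ x := by linarith
  refine ⟨(Nat.one_le_floor_iff x).2 (by linarith), Nat.floor_le h0, ?_⟩
  have := Nat.lt_floor_add_one x
  linarith

/-- **The `ε`-term of Prop. 5.8 is negligible against the rate.** With `ℓ = log (N+1)`,
`L = log ℓ` and `ε^{d-1} = α/(N+1) = α e^{-ℓ}`: if `α ≤ c₁ L`, `L ≥ 1` and
`ℓ ≥ max(1, (4 (c₁ + A + C)(n+1))⁴)`, then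
`(α e^{-ℓ})^{1/(n+1)} e^{C √ℓ L} L^A ≤ exp(c₁ L + C √ℓ L + A L - ℓ/(n+1)) ≤ 1`, using
`α^{1/(n+1)} ≤ 1 + α ≤ e^{α}`, `L^A = e^{A log L} ≤ e^{AL}`, `L = log ℓ ≤ 4 ℓ^{1/4}`
(`Real.log_le_rpow_div`) and `ℓ^{1/4} ≥ 4 (c₁ + A + C)(n+1)` (BGSR p. 21: "from which (5.25)
can be deduced … since `A^K ≤ √(log N)`", and the absorption of
`ε^{(d-1)/(d+1)} exp(C √(log N) log log N)` into `(log log N)^{-A}`). [folklore] -/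
theorem rate_epsTerm_mul_le_one {n : ℕ} {c₁ A C α ℓ : ℝ} (hc₁ : 0 < c₁) (hA : 0 ≤ A)
    (hC : 0 ≤ C) (hℓ1 : 1 ≤ ℓ) (hℓ : (4 * (c₁ + A + C) * (n + 1)) ^ 4 ≤ ℓ)
    (hL1 : 1 ≤ Real.log ℓ) (hα0 : 0 ≤ α) (hα : α ≤ c₁ * Real.log ℓ) :
    (α / Real.exp ℓ) ^ (1 / (n + 1 : ℝ)) * Real.exp (C * Real.sqrt ℓ * Real.log ℓ) *
      Real.log ℓ ^ A ≤ 1 := by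
  set L := Real.log ℓ with hL_def
  set p : ℝ := 1 / (n + 1 : ℝ) with hp_def
  set B : ℝ := 4 * (c₁ + A + C) with hB_def
  have hn1 : (0 : ℝ) < n + 1 := by positivity
  have hp0 : 0 < p := by positivity
  have hp1 : p ≤ 1 := by
    rw [hp_def, div_le_one hn1]
    linarith [(n.cast_nonneg : (0 : ℝ) ≤ n)]
  have hL0 : 0 < L := by linarith
  have hℓ0 : 0 < ℓ := by linarith
  have hB0 : 0 ≤ B := by
    rw [hB_def]
    positivity
  -- `α^p ≤ e^{c₁ L}`
  have h1 : α ^ p ≤ Real.exp (c₁ * L) := by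
    have hmax : α ^ p ≤ α + 1 := by
      rcases le_or_gt α 1 with hle | hlt
      · exact (rpow_le_one hα0 hle hp0.le).trans (by linarith)
      · calc α ^ p ≤ α ^ (1 : ℝ) := rpow_le_rpow_of_exponent_le hlt.le hp1
          _ = α := rpow_one α
          _ ≤ α + 1 := by linarith
    calc α ^ p ≤ α + 1 := hmax
      _ ≤ Real.exp α := add_one_le_exp α
      _ ≤ Real.exp (c₁ * L) := exp_le_exp.2 hα
  -- `L^A ≤ e^{A L}`
  have h2 : L ^ A ≤ Real.exp (A * L) := by
    rw [rpow_def_of_pos hL0]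
    exact exp_le_exp.2 (by nlinarith [log_le_sub_one_of_pos hL0])
  -- `(e^ℓ)^p = e^{pℓ}`
  have h3 : (α / Real.exp ℓ) ^ p = α ^ p / Real.exp (p * ℓ) := by
    rw [div_rpow hα0 (exp_pos ℓ).le, ← exp_mul, mul_comm ℓ p]
  -- `L ≤ 4 ℓ^{1/4}`
  have h4 : L ≤ 4 * ℓ ^ (1 / 4 : ℝ) := by
    have h := log_le_rpow_div hℓ0.le (by norm_num : (0 : ℝ) < 1 / 4)
    rw [div_eq_mul_inv, show ((1 : ℝ) / 4)⁻¹ = 4 by norm_num] at h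
    linarith
  -- `√ℓ L ≤ 4 ℓ^{3/4}`
  have h14 : 0 ≤ ℓ ^ (1 / 4 : ℝ) := rpow_nonneg hℓ0.le _
  have h34 : 0 ≤ ℓ ^ (3 / 4 : ℝ) := rpow_nonneg hℓ0.le _
  have hprod : ℓ ^ (1 / 2 : ℝ) * ℓ ^ (1 / 4 : ℝ) = ℓ ^ (3 / 4 : ℝ) := by
    rw [← rpow_add hℓ0]
    norm_num
  have h5 : Real.sqrt ℓ * L ≤ 4 * ℓ ^ (3 / 4 : ℝ) := by
    calc Real.sqrt ℓ * L ≤ Real.sqrt ℓ * (4 * ℓ ^ (1 / 4 : ℝ)) :=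
          mul_le_mul_of_nonneg_left h4 (sqrt_nonneg ℓ)
      _ = 4 * ℓ ^ (3 / 4 : ℝ) := by rw [sqrt_eq_rpow, ← hprod]; ring
  -- `ℓ^{1/4} ≤ ℓ^{3/4}`
  have h6 : ℓ ^ (1 / 4 : ℝ) ≤ ℓ ^ (3 / 4 : ℝ) := rpow_le_rpow_of_exponent_le hℓ1 (by norm_num)
  -- `B (n+1) ≤ ℓ^{1/4}`
  have h7 : B * (n + 1) ≤ ℓ ^ (1 / 4 : ℝ) := by
    have hx0 : 0 ≤ B * (n + 1) := by positivity
    have hroot : ((B * (n + 1)) ^ 4) ^ (1 / 4 : ℝ) = B * (n + 1) := by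
      rw [show (1 / 4 : ℝ) = ((4 : ℕ) : ℝ)⁻¹ by norm_num]
      exact pow_rpow_inv_natCast hx0 four_ne_zero
    calc B * (n + 1) = ((B * (n + 1)) ^ 4) ^ (1 / 4 : ℝ) := hroot.symm
      _ ≤ ℓ ^ (1 / 4 : ℝ) := rpow_le_rpow (by positivity) hℓ (by norm_num)
  -- `B ℓ^{3/4} ≤ p ℓ`
  have hℓsplit : ℓ ^ (1 / 4 : ℝ) * ℓ ^ (3 / 4 : ℝ) = ℓ := by
    rw [← rpow_add hℓ0]
    norm_num
  have h8 : B * ℓ ^ (3 / 4 : ℝ) ≤ p * ℓ := by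
    have h := mul_le_mul_of_nonneg_right h7 h34
    rw [hℓsplit] at h
    rw [hp_def, one_div, inv_mul_eq_div, le_div_iff₀ hn1]
    linarith [h]
  -- the exponent is nonpositive
  have hexp : c₁ * L + C * Real.sqrt ℓ * L + A * L - p * ℓ ≤ 0 := by
    have e1 : c₁ * L ≤ c₁ * (4 * ℓ ^ (3 / 4 : ℝ)) :=
      mul_le_mul_of_nonneg_left (h4.trans (by linarith)) hc₁.le
    have e2 : A * L ≤ A * (4 * ℓ ^ (3 / 4 : ℝ)) :=
      mul_le_mul_of_nonneg_left (h4.trans (by linarith)) hA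
    have e3 : C * (Real.sqrt ℓ * L) ≤ C * (4 * ℓ ^ (3 / 4 : ℝ)) :=
      mul_le_mul_of_nonneg_left h5 hC
    have e4 : c₁ * L + C * Real.sqrt ℓ * L + A * L ≤ B * ℓ ^ (3 / 4 : ℝ) := by
      rw [hB_def]
      linarith [e1, e2, e3]
    linarith [e4, h8]
  calc (α / Real.exp ℓ) ^ p * Real.exp (C * Real.sqrt ℓ * L) * L ^ A
      ≤ Real.exp (c₁ * L) / Real.exp (p * ℓ) * Real.exp (C * Real.sqrt ℓ * L) *
          Real.exp (A * L) := by
        rw [h3]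
        refine mul_le_mul (mul_le_mul_of_nonneg_right
          (div_le_div_of_nonneg_right h1 (exp_pos _).le) (exp_pos _).le) h2
          (rpow_nonneg hL0.le A) (by positivity)
    _ = Real.exp (c₁ * L + C * Real.sqrt ℓ * L + A * L - p * ℓ) := by
        rw [Real.exp_sub, Real.exp_add, Real.exp_add]
        ring
    _ ≤ Real.exp 0 := exp_le_exp.2 hexp
    _ = 1 := Real.exp_zero

/-- **The regime estimate.** If `γ = a^{A/(A-1)}/(κ₁ K)` (the printed choice (4.13),
`γ = (αt)^{A/(A-1)}/(cK)`) with `K ≥ c₂ L/2 > 0`, `a ≥ 1`, `L ≥ 1`, `A ≥ 2` and the `ε`-term `E`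
satisfies `E L^A ≤ 1`, then `C₁ (γ^A + E) ≤ C₁ ((2/(κ₁c₂))^A + 1) a^{A²/(A-1)} / L^A`
(`C₁ ≥ 0`): the right-hand side of the pruned comparison is dominated by the rate (2.9) (BGSR
p. 21, second inequality of the proof of Thm 2.2: `C (γ^A + …) ≤ C ((αt)^{A/(A-1)}/log log N)^A`).
[cite: BodineauGallagherSaintRaymondInvent2016, proof of Thm. 2.2, p. 21] -/
theorem rate_regime_bound {A κ₁ c₂ C₁ L a K γ E : ℝ} (hA : 2 ≤ A) (hκ₁ : 0 < κ₁) (hc₂ : 0 < c₂)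
    (hC₁ : 0 ≤ C₁) (hL1 : 1 ≤ L) (ha1 : 1 ≤ a) (hK0 : 0 < K) (hKge : c₂ * L / 2 ≤ K)
    (hγ : γ = a ^ (A / (A - 1)) / (κ₁ * K)) (hE : E * L ^ A ≤ 1) :
    C₁ * (γ ^ A + E) ≤ C₁ * ((2 / (κ₁ * c₂)) ^ A + 1) * (a ^ (A ^ 2 / (A - 1)) / L ^ A) := by
  have hL0 : 0 < L := by linarith
  have ha0 : 0 ≤ a := by linarith
  have hA0 : 0 ≤ A := by linarith
  have hLA : 0 < L ^ A := rpow_pos_of_pos hL0 A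
  set b : ℝ := a ^ (A / (A - 1)) with hb_def
  have hb0 : 0 ≤ b := rpow_nonneg ha0 _
  have hbA : b ^ A = a ^ (A ^ 2 / (A - 1)) := by
    rw [hb_def, ← rpow_mul ha0, div_mul_eq_mul_div, ← pow_two]
  have hγ0 : 0 ≤ γ := by
    rw [hγ]
    positivity
  -- `γ ≤ (2/(κ₁c₂)) b / L`
  have hγle : γ ≤ 2 / (κ₁ * c₂) * b / L := by
    rw [hγ, div_le_div_iff₀ (by positivity) hL0]
    have h := mul_le_mul_of_nonneg_left hKge (by positivity : (0 : ℝ) ≤ 2 * κ₁ * b)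
    calc b * L = 2 * κ₁ * b * (c₂ * L / 2) * (1 / (κ₁ * c₂)) := by field_simp
      _ ≤ 2 * κ₁ * b * K * (1 / (κ₁ * c₂)) :=
          mul_le_mul_of_nonneg_right h (by positivity)
      _ = 2 / (κ₁ * c₂) * b * (κ₁ * K) := by field_simp
  have hγA : γ ^ A ≤ (2 / (κ₁ * c₂)) ^ A * a ^ (A ^ 2 / (A - 1)) / L ^ A := by
    calc γ ^ A ≤ (2 / (κ₁ * c₂) * b / L) ^ A := rpow_le_rpow hγ0 hγle hA0
      _ = (2 / (κ₁ * c₂)) ^ A * b ^ A / L ^ A := by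
          rw [div_rpow (by positivity) hL0.le, mul_rpow (by positivity) hb0]
      _ = (2 / (κ₁ * c₂)) ^ A * a ^ (A ^ 2 / (A - 1)) / L ^ A := by rw [hbA]
  have he0 : 0 ≤ A ^ 2 / (A - 1) := div_nonneg (sq_nonneg A) (by linarith)
  have hae1 : 1 ≤ a ^ (A ^ 2 / (A - 1)) := one_le_rpow ha1 he0
  have hE' : E ≤ a ^ (A ^ 2 / (A - 1)) / L ^ A := by
    rw [le_div_iff₀ hLA]
    exact hE.trans hae1
  have hsum : γ ^ A + E ≤ ((2 / (κ₁ * c₂)) ^ A + 1) * (a ^ (A ^ 2 / (A - 1)) / L ^ A) := by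
    calc γ ^ A + E ≤ (2 / (κ₁ * c₂)) ^ A * a ^ (A ^ 2 / (A - 1)) / L ^ A +
          a ^ (A ^ 2 / (A - 1)) / L ^ A := add_le_add hγA hE'
      _ = ((2 / (κ₁ * c₂)) ^ A + 1) * (a ^ (A ^ 2 / (A - 1)) / L ^ A) := by ring
  calc C₁ * (γ ^ A + E) ≤ C₁ * (((2 / (κ₁ * c₂)) ^ A + 1) * (a ^ (A ^ 2 / (A - 1)) / L ^ A)) :=
        mul_le_mul_of_nonneg_left hsum hC₁
    _ = C₁ * ((2 / (κ₁ * c₂)) ^ A + 1) * (a ^ (A ^ 2 / (A - 1)) / L ^ A) := by ring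

/-- **The complementary regime.** If the rate `T` exceeds `c^e` (`c > 0`), a quantity bounded by
`2 R M₀` (`R, M₀ ≥ 0`) is at most `(2 R M₀ / c^e + 1) T` (BGSR (2.9) outside the regime
`αt ≲ (log log N)^{(A-1)/A}`, where it is implied by Prop. 4.1 and Remark 3.5). [folklore] -/
theorem rate_trivial_bound {R M₀ c e T : ℝ} (hR : 0 ≤ R) (hM : 0 ≤ M₀) (hc : 0 < c)
    (hT : c ^ e < T) : 2 * R * M₀ ≤ (2 * R * M₀ / c ^ e + 1) * T := by
  have hce : 0 < c ^ e := rpow_pos_of_pos hc e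
  have hT0 : 0 ≤ T := (hce.trans hT).le
  have h1 : 2 * R * M₀ = 2 * R * M₀ / c ^ e * c ^ e := by field_simp
  calc 2 * R * M₀ = 2 * R * M₀ / c ^ e * c ^ e := h1
    _ ≤ 2 * R * M₀ / c ^ e * T := mul_le_mul_of_nonneg_left hT.le (by positivity)
    _ ≤ (2 * R * M₀ / c ^ e + 1) * T := by nlinarith

end RealLemmas

/-! ## The trivial bound (Prop. 4.1 and Remark 3.5) -/

section Trivial

variable {ε β : ℝ} {N : ℕ} {ρ₀ : UnitAddTorus d → ℝ} {R : ℝ}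

/-- **The trivial bound**: `|f_N^{(1)}(t, x, v) - M_β(v) φ(t, x, v)| ≤ 2 R (2π/β)^{-d/2}` for
every `t, x, v`, as soon as `0 ≤ ρ⁰ ≤ R` and `0 ≤ φ ≤ R`: from `0 ≤ f_N^{(1)} ≤ R M_β` (BGSR
Prop. 4.1 for `s = 1`, `bgsrTaggedMarginal_le`, maximum principle for the Liouville equation),
`0 ≤ φ_α ≤ ‖ρ⁰‖_∞` (Remark 3.5) and `M_β ≤ (2π/β)^{-d/2}` (`maxwellianBeta_le`).
[cite: BodineauGallagherSaintRaymondInvent2016, Prop. 4.1 and Remark 3.5] -/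
theorem abs_bgsrTaggedMarginal_sub_mul_le (hβ : 0 < β) (hρ₀0 : ∀ x, 0 ≤ ρ₀ x)
    (hR : ∀ x, ρ₀ x ≤ R) (Φ : HardSphereFlow (Torus.geometry d) ε (N + 1))
    {φ : ℝ → UnitAddTorus d → EuclideanSpace ℝ d → ℝ} (hφ : ∀ t x v, 0 ≤ φ t x v ∧ φ t x v ≤ R)
    (t : ℝ) (x : UnitAddTorus d) (v : EuclideanSpace ℝ d) :
    |bgsrTaggedMarginal Φ β ρ₀ t x v - maxwellianBeta β v * φ t x v| ≤
      2 * R * (2 * Real.pi * β⁻¹) ^ (-(Module.finrank ℝ (EuclideanSpace ℝ d) : ℝ) / 2) := by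
  set M₀ : ℝ := (2 * Real.pi * β⁻¹) ^ (-(Module.finrank ℝ (EuclideanSpace ℝ d) : ℝ) / 2)
    with hM₀_def
  have hR0 : 0 ≤ R := (hρ₀0 0).trans (hR 0)
  have hf0 := bgsrTaggedMarginal_nonneg hβ hρ₀0 Φ t x v
  have hf1 := bgsrTaggedMarginal_le hβ hρ₀0 hR Φ t x v
  have hM0 : 0 ≤ maxwellianBeta β v := (maxwellianBeta_pos hβ v).le
  have hM1 : maxwellianBeta β v ≤ M₀ := maxwellianBeta_le hβ v
  obtain ⟨hφ0, hφ1⟩ := hφ t x v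
  have hup : bgsrTaggedMarginal Φ β ρ₀ t x v ≤ R * M₀ :=
    hf1.trans (mul_le_mul_of_nonneg_left hM1 hR0)
  have hup' : maxwellianBeta β v * φ t x v ≤ M₀ * R := mul_le_mul hM1 hφ1 hφ0 (hM0.trans hM1)
  have hlow' : 0 ≤ maxwellianBeta β v * φ t x v := mul_nonneg hM0 hφ0
  rw [abs_le]
  constructor <;> nlinarith

end Trivial

/-! ## Theorem 2.2 (uniform form) from the pruned comparison -/

section Assembly

/-- **BGSR Theorem 2.2 in its uniform-rate form from the pruned comparison** (proof of Thm 2.2,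
p. 21 of arXiv:1305.3397v2). *Hypothesis* (inline; the first display of the printed proof, i.e.
Prop. 4.3 for both hierarchies in the step-condition form of the tree's pruning layer
`HierarchyPruningEstimates` — `tα ≤ κ₁ γ K` for `K` blocks of length `h = t/K`, `0 < γ ≤ 1/2` —
plus the term-by-term comparison Prop. 5.8 in its regime `tα ≤ c₁ (log log (N+1))^{(A-1)/A}`,
`K ≤ c₂ log log (N+1)`): for `d ≥ 2`, `β > 0`, `A ≥ 2`, `R ≥ 0` there are `κ₁, c₁, c₂ > 0`, `C₁`,
`N₁` such that for all `N ≥ N₁`, `0 < ε < 1/2` with `α := (N+1) ε^{d-1} > 1`, every continuous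
probability density `0 ≤ ρ⁰ ≤ R` on `T^d`, every hard-sphere flow of the `N+1` spheres, every
`t > 1`, `1 ≤ K ≤ c₂ log log (N+1)` and `0 < γ ≤ 1/2` with `tα ≤ κ₁ γ K`,
`(tα)^{A/(A-1)} ≤ κ₁ γ K` and
`tα ≤ c₁ (log log (N+1))^{(A-1)/A}`: for a.e. `(x, v)`,
`|f_N^{(1)}(t,x,v) - M_β(v) φ_α(t,x,v)| ≤ C₁ (γ^A + ε^{(d-1)/(d+1)} exp(C₁ √(log (N+1))
log log (N+1)))`, where `f_N^{(1)} = bgsrTaggedMarginal` and `φ_α` is the collision series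
`linearBoltzmannSeries (Torus.geometry d) β α ρ⁰` (the solution of (1.3), unique in the class
`IsTaggedLinearBoltzmannSolution β α ρ⁰`); both step conditions are offered,
`tα ≤ κ₁ γ K` (the form the tree's `HierarchyPruningEstimates` consumes) and
`(tα)^{A/(A-1)} ≤ κ₁ γ K` (the printed (4.13)). *Conclusion:* the named fact
`bgsr_linearBoltzmannApprox` — (2.9) with `C, N₀` depending on `d, β, A, R` only, for all
`t > 1`, `α > 1`. The proof is the parameter tuning of p. 21 (`K = ⌊c₂ log log (N+1)⌋`,
`γ = (tα)^{A/(A-1)}/(κ₁K)`), made uniform: see the module docstring.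
[cite: BodineauGallagherSaintRaymondInvent2016, Thm. 2.2 (2.9) and its proof p. 21] -/
theorem bgsr_linearBoltzmannApprox_of_prunedComparison
    (H : ∀ (_hd : 2 ≤ Fintype.card d) {β : ℝ} (_hβ : 0 < β) {A : ℝ} (_hA : 2 ≤ A) {R : ℝ}
      (_hR : 0 ≤ R),
      ∃ κ₁ : ℝ, 0 < κ₁ ∧ ∃ c₁ : ℝ, 0 < c₁ ∧ ∃ c₂ : ℝ, 0 < c₂ ∧ ∃ C₁ : ℝ, ∃ N₁ : ℕ,
        ∀ N : ℕ, N₁ ≤ N → ∀ ε : ℝ, 0 < ε → ε < 2⁻¹ →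
        1 < (N + 1 : ℝ) * ε ^ (Fintype.card d - 1) →
        ∀ ρ₀ : UnitAddTorus d → ℝ, Continuous ρ₀ → (∀ x, 0 ≤ ρ₀ x) → (∀ x, ρ₀ x ≤ R) →
        ∫ x, ρ₀ x = 1 →
        ∀ Φ : HardSphereFlow (Torus.geometry d) ε (N + 1),
        ∀ t : ℝ, 1 < t → ∀ K : ℕ, 1 ≤ K → (K : ℝ) ≤ c₂ * Real.log (Real.log (N + 1)) →
        ∀ γ : ℝ, 0 < γ → γ ≤ 2⁻¹ →
        t * ((N + 1 : ℝ) * ε ^ (Fintype.card d - 1)) ≤ κ₁ * γ * K →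
        (t * ((N + 1 : ℝ) * ε ^ (Fintype.card d - 1))) ^ (A / (A - 1)) ≤ κ₁ * γ * K →
        t * ((N + 1 : ℝ) * ε ^ (Fintype.card d - 1)) ≤
          c₁ * Real.log (Real.log (N + 1)) ^ ((A - 1) / A) →
        ∀ᵐ z : UnitAddTorus d × EuclideanSpace ℝ d,
          |bgsrTaggedMarginal Φ β ρ₀ t z.1 z.2 - maxwellianBeta β z.2 *
              linearBoltzmannSeries (Torus.geometry d) β ((N + 1 : ℝ) * ε ^ (Fintype.card d - 1))
                (fun x _ => ρ₀ x) t z.1 z.2| ≤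
            C₁ * (γ ^ A + ε ^ (((Fintype.card d : ℝ) - 1) / ((Fintype.card d : ℝ) + 1)) *
              Real.exp (C₁ * Real.sqrt (Real.log (N + 1)) * Real.log (Real.log (N + 1))))) :
    bgsr_linearBoltzmannApprox (d := d) := by
  intro hd β hβ A hA R hR
  obtain ⟨κ₁, hκ₁, c₁, hc₁, c₂, hc₂, C₁, N₁, hH⟩ := H hd hβ hA hR
  -- the constants
  have hA0 : 0 < A := by linarith
  have hA1 : 0 < A - 1 := by linarith
  have he0 : 0 < A ^ 2 / (A - 1) := by positivity
  set M₀ : ℝ := (2 * Real.pi * β⁻¹) ^ (-(Module.finrank ℝ (EuclideanSpace ℝ d) : ℝ) / 2)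
    with hM₀_def
  have hM₀ : 0 ≤ M₀ := rpow_nonneg (by positivity) _
  set C₁' : ℝ := max C₁ 1 with hC₁'_def
  have hC₁' : 0 ≤ C₁' := le_max_of_le_right zero_le_one
  have hC₁le : C₁ ≤ C₁' := le_max_left _ _
  set c : ℝ := min (min c₁ 1) (κ₁ * c₂ / 4) with hc_def
  have hc0 : 0 < c := lt_min (lt_min hc₁ one_pos) (by positivity)
  have hc1 : c ≤ 1 := (min_le_left _ _).trans (min_le_right _ _)
  have hcc₁ : c ≤ c₁ := (min_le_left _ _).trans (min_le_left _ _)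
  have hcκ : c ≤ κ₁ * c₂ / 4 := min_le_right _ _
  have hr1 : 1 ≤ A / (A - 1) := by
    rw [le_div_iff₀ hA1]
    linarith
  have hcr : c ^ (A / (A - 1)) ≤ c := by
    simpa using rpow_le_rpow_of_exponent_ge hc0 hc1 hr1
  set Creg : ℝ := C₁' * ((2 / (κ₁ * c₂)) ^ A + 1) with hCreg_def
  set Cout : ℝ := 2 * R * M₀ / c ^ (A ^ 2 / (A - 1)) + 1 with hCout_def
  have hCout : 0 < Cout := by
    have : 0 ≤ 2 * R * M₀ / c ^ (A ^ 2 / (A - 1)) :=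
      div_nonneg (by positivity) (rpow_nonneg hc0.le _)
    linarith
  set n : ℕ := Fintype.card d with hn_def
  set ℓ₀ : ℝ := max 1 ((4 * (c₁ + A + C₁') * (n + 1)) ^ 4) with hℓ₀_def
  set L₀ : ℝ := max 1 (2 / c₂) with hL₀_def
  -- largeness of `N`, uniformly in everything else
  have hlog1 : Tendsto (fun N : ℕ => Real.log ((N : ℝ) + 1)) atTop atTop :=
    tendsto_log_atTop.comp (tendsto_atTop_add_const_right atTop (1 : ℝ)
      tendsto_natCast_atTop_atTop)
  have hlog2 : Tendsto (fun N : ℕ => Real.log (Real.log ((N : ℝ) + 1))) atTop atTop :=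
    tendsto_log_atTop.comp hlog1
  obtain ⟨N₂, hN₂⟩ := eventually_atTop.1
    ((hlog1.eventually_ge_atTop ℓ₀).and (hlog2.eventually_ge_atTop L₀))
  refine ⟨max Creg Cout, lt_max_of_lt_right hCout, max N₁ N₂, ?_⟩
  intro N hN ε hε hε2 hα1 ρ₀ hρc hρ0 hρR hρ1 Φ
  have hNN₁ : N₁ ≤ N := le_of_max_le_left hN
  obtain ⟨hℓ, hL⟩ := hN₂ N (le_of_max_le_right hN)
  set α : ℝ := (N + 1 : ℝ) * ε ^ (n - 1) with hα_def
  set ℓ : ℝ := Real.log (N + 1) with hℓ_def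
  set L : ℝ := Real.log ℓ with hL_def
  have hα0 : 0 ≤ α := by positivity
  have hℓ1 : 1 ≤ ℓ := le_trans (le_max_left _ _) hℓ
  have hℓB : (4 * (c₁ + A + C₁') * (n + 1)) ^ 4 ≤ ℓ := le_trans (le_max_right _ _) hℓ
  have hL1 : 1 ≤ L := le_trans (le_max_left _ _) hL
  have hL0 : 0 < L := by linarith
  have hLc₂ : 2 ≤ c₂ * L := by
    have h := mul_le_mul_of_nonneg_left (le_trans (le_max_right _ _) hL) hc₂.le
    rwa [mul_div_cancel₀ _ hc₂.ne'] at h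
  have hq1 : (A - 1) / A ≤ 1 := by
    rw [div_le_one hA0]
    linarith
  have hLq : L ^ ((A - 1) / A) ≤ L :=
    (rpow_le_rpow_of_exponent_le hL1 hq1).trans_eq (rpow_one L)
  have hLq0 : 0 < L ^ ((A - 1) / A) := rpow_pos_of_pos hL0 _
  -- the solution `φ_α` of (1.3): the collision series
  obtain ⟨hφsol, hφR⟩ := isTaggedLinearBoltzmannSolution_linearBoltzmannSeries hβ hα0 hρc hρ0 hρR
  refine ⟨_, hφsol, fun t ht => ?_⟩
  have ht0 : 0 ≤ t := by linarith
  have hta1 : 1 ≤ t * α := one_le_mul_of_one_le_of_one_le ht.le hα1.le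
  have hta0 : 0 ≤ t * α := by positivity
  have hT : (t * α / L ^ ((A - 1) / A)) ^ (A ^ 2 / (A - 1)) =
      (t * α) ^ (A ^ 2 / (A - 1)) / L ^ A := rate_rpow_eq hta0 hL0.le hA
  have hT0 : 0 ≤ (t * α / L ^ ((A - 1) / A)) ^ (A ^ 2 / (A - 1)) :=
    rpow_nonneg (div_nonneg hta0 hLq0.le) _
  -- the almost-everywhere bound by `max Creg Cout` times the rate
  have key : ∀ᵐ z : UnitAddTorus d × EuclideanSpace ℝ d,
      |bgsrTaggedMarginal Φ β ρ₀ t z.1 z.2 - maxwellianBeta β z.2 *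
          linearBoltzmannSeries (Torus.geometry d) β α (fun x _ => ρ₀ x) t z.1 z.2| ≤
        max Creg Cout * (t * α / L ^ ((A - 1) / A)) ^ (A ^ 2 / (A - 1)) := by
    by_cases hreg : t * α ≤ c * L ^ ((A - 1) / A)
    · -- the regime `tα ≤ c L^{(A-1)/A}`: pruned comparison with `K = ⌊c₂ L⌋` blocks and
      -- `γ = (tα)^{A/(A-1)}/(κ₁ K)`
      obtain ⟨hK1, hKle, hKge⟩ := one_le_floor_and_le hLc₂
      have hK0 : (0 : ℝ) < (⌊c₂ * L⌋₊ : ℕ) := by exact_mod_cast hK1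
      set γ : ℝ := t * α / (κ₁ * ⌊c₂ * L⌋₊) with hγ_def
      have hκK : 0 < κ₁ * (⌊c₂ * L⌋₊ : ℕ) := mul_pos hκ₁ hK0
      have htar : t * α ≤ (t * α) ^ (A / (A - 1)) := by
        simpa using rpow_le_rpow_of_exponent_le hta1 hr1
      have htar0 : 0 < (t * α) ^ (A / (A - 1)) := rpow_pos_of_pos (lt_of_lt_of_le one_pos hta1) _
      set γ : ℝ := (t * α) ^ (A / (A - 1)) / (κ₁ * ⌊c₂ * L⌋₊) with hγ_def
      have hγ0 : 0 < γ := by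
        rw [hγ_def]
        exact div_pos htar0 hκK
      have hstep' : (t * α) ^ (A / (A - 1)) ≤ κ₁ * γ * ⌊c₂ * L⌋₊ := by
        rw [hγ_def]
        apply le_of_eq
        calc (t * α) ^ (A / (A - 1))
            = (t * α) ^ (A / (A - 1)) / (κ₁ * (⌊c₂ * L⌋₊ : ℕ)) * (κ₁ * (⌊c₂ * L⌋₊ : ℕ)) :=
              (div_mul_cancel₀ _ hκK.ne').symm
          _ = κ₁ * ((t * α) ^ (A / (A - 1)) / (κ₁ * (⌊c₂ * L⌋₊ : ℕ))) * (⌊c₂ * L⌋₊ : ℕ) := by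
              ring
      have hstep : t * α ≤ κ₁ * γ * ⌊c₂ * L⌋₊ := htar.trans hstep'
      have htac : t * α ≤ c * L := hreg.trans (mul_le_mul_of_nonneg_left hLq hc0.le)
      -- `(tα)^{A/(A-1)} ≤ c^{A/(A-1)} L ≤ c L`
      have htarc : (t * α) ^ (A / (A - 1)) ≤ c * L := by
        have h1 : (t * α) ^ (A / (A - 1)) ≤ (c * L ^ ((A - 1) / A)) ^ (A / (A - 1)) :=
          rpow_le_rpow hta0 hreg (by positivity)
        have h2 : (c * L ^ ((A - 1) / A)) ^ (A / (A - 1)) = c ^ (A / (A - 1)) * L := by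
          rw [mul_rpow hc0.le hLq0.le, ← rpow_mul hL0.le]
          have : (A - 1) / A * (A / (A - 1)) = 1 := by
            field_simp
          rw [this, rpow_one]
        rw [h2] at h1
        exact h1.trans (mul_le_mul_of_nonneg_right hcr hL0.le)
      have hγhalf : γ ≤ 2⁻¹ := by
        rw [hγ_def, div_le_iff₀ hκK]
        have h1 : c * L ≤ κ₁ * c₂ / 4 * L := mul_le_mul_of_nonneg_right hcκ hL0.le
        have h2 : κ₁ * c₂ / 4 * L = κ₁ / 2 * (c₂ * L / 2) := by ring
        have h3 : κ₁ / 2 * (c₂ * L / 2) ≤ κ₁ / 2 * (⌊c₂ * L⌋₊ : ℕ) :=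
          mul_le_mul_of_nonneg_left hKge (by positivity)
        calc (t * α) ^ (A / (A - 1)) ≤ c * L := htarc
          _ ≤ κ₁ / 2 * (⌊c₂ * L⌋₊ : ℕ) := by linarith [h1, h2, h3]
          _ = 2⁻¹ * (κ₁ * (⌊c₂ * L⌋₊ : ℕ)) := by ring
      have hreg' : t * α ≤ c₁ * L ^ ((A - 1) / A) :=
        hreg.trans (mul_le_mul_of_nonneg_right hcc₁ hLq0.le)
      have hae := hH N hNN₁ ε hε hε2 hα1 ρ₀ hρc hρ0 hρR hρ1 Φ t ht ⌊c₂ * L⌋₊ hK1 hKle γ hγ0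
        hγhalf hstep hstep' hreg'
      refine hae.mono fun z hz => hz.trans ?_
      -- the `ε`-term with `C₁'`
      set E : ℝ := ε ^ (((n : ℝ) - 1) / ((n : ℝ) + 1)) * Real.exp (C₁' * Real.sqrt ℓ * L)
        with hE_def
      have hεr0 : 0 ≤ ε ^ (((n : ℝ) - 1) / ((n : ℝ) + 1)) := rpow_nonneg hε.le _
      have hsL : 0 ≤ Real.sqrt ℓ * L := mul_nonneg (sqrt_nonneg ℓ) hL0.le
      -- `C₁ (γ^A + …C₁…) ≤ C₁' (γ^A + E)`
      have hmono : C₁ * (γ ^ A + ε ^ (((n : ℝ) - 1) / ((n : ℝ) + 1)) *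
            Real.exp (C₁ * Real.sqrt ℓ * L)) ≤ C₁' * (γ ^ A + E) := by
        have hexp : Real.exp (C₁ * Real.sqrt ℓ * L) ≤ Real.exp (C₁' * Real.sqrt ℓ * L) := by
          rw [exp_le_exp, mul_assoc, mul_assoc]
          exact mul_le_mul_of_nonneg_right hC₁le hsL
        have hX0 : 0 ≤ γ ^ A + ε ^ (((n : ℝ) - 1) / ((n : ℝ) + 1)) *
            Real.exp (C₁ * Real.sqrt ℓ * L) :=
          add_nonneg (rpow_nonneg hγ0.le A) (mul_nonneg hεr0 (exp_pos _).le)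
        have hXle : γ ^ A + ε ^ (((n : ℝ) - 1) / ((n : ℝ) + 1)) *
            Real.exp (C₁ * Real.sqrt ℓ * L) ≤ γ ^ A + E :=
          add_le_add le_rfl (mul_le_mul_of_nonneg_left hexp hεr0)
        calc C₁ * (γ ^ A + ε ^ (((n : ℝ) - 1) / ((n : ℝ) + 1)) *
              Real.exp (C₁ * Real.sqrt ℓ * L))
            ≤ C₁' * (γ ^ A + ε ^ (((n : ℝ) - 1) / ((n : ℝ) + 1)) *
              Real.exp (C₁ * Real.sqrt ℓ * L)) := mul_le_mul_of_nonneg_right hC₁le hX0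
          _ ≤ C₁' * (γ ^ A + E) := mul_le_mul_of_nonneg_left hXle hC₁'
      -- `E L^A ≤ 1`
      have hEL : E * L ^ A ≤ 1 := by
        have hn1 : 1 ≤ n := le_trans (by norm_num) hd
        have hN1 : (0 : ℝ) < N + 1 := by positivity
        have hεpow : ε ^ (n - 1) = α / Real.exp ℓ := by
          rw [hℓ_def, Real.exp_log hN1, hα_def]
          field_simp
        have hεr : ε ^ (((n : ℝ) - 1) / ((n : ℝ) + 1)) =
            (α / Real.exp ℓ) ^ (1 / (n + 1 : ℝ)) := by
          rw [← hεpow, ← rpow_natCast ε (n - 1), ← rpow_mul hε.le, Nat.cast_sub hn1,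
            Nat.cast_one]
          congr 1
          field_simp
        have hαc₁ : α ≤ c₁ * Real.log ℓ := by
          have h1 : α ≤ t * α := le_mul_of_one_le_left hα0 ht.le
          have h2 : c * L ≤ c₁ * L := mul_le_mul_of_nonneg_right hcc₁ hL0.le
          linarith [htac]
        have h := rate_epsTerm_mul_le_one (n := n) hc₁ hA0.le hC₁' hℓ1 hℓB hL1 hα0 hαc₁
        rw [hE_def, hεr]
        exact h
      have hbound := rate_regime_bound hA hκ₁ hc₂ hC₁' hL1 hta1 hK0 hKge hγ_def hEL
      calc C₁ * (γ ^ A + ε ^ (((n : ℝ) - 1) / ((n : ℝ) + 1)) *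
            Real.exp (C₁ * Real.sqrt ℓ * L))
          ≤ C₁' * (γ ^ A + E) := hmono
        _ ≤ Creg * ((t * α) ^ (A ^ 2 / (A - 1)) / L ^ A) := hbound
        _ = Creg * (t * α / L ^ ((A - 1) / A)) ^ (A ^ 2 / (A - 1)) := by rw [hT]
        _ ≤ max Creg Cout * (t * α / L ^ ((A - 1) / A)) ^ (A ^ 2 / (A - 1)) :=
            mul_le_mul_of_nonneg_right (le_max_left _ _) hT0
    · -- the complementary regime: the rate exceeds `c^{A²/(A-1)}`
      refine Eventually.of_forall fun z => ?_
      have hlt : c < t * α / L ^ ((A - 1) / A) := by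
        rw [lt_div_iff₀ hLq0]
        exact lt_of_not_ge hreg
      have hTc : c ^ (A ^ 2 / (A - 1)) < (t * α / L ^ ((A - 1) / A)) ^ (A ^ 2 / (A - 1)) :=
        rpow_lt_rpow hc0.le hlt he0
      calc |bgsrTaggedMarginal Φ β ρ₀ t z.1 z.2 - maxwellianBeta β z.2 *
            linearBoltzmannSeries (Torus.geometry d) β α (fun x _ => ρ₀ x) t z.1 z.2|
          ≤ 2 * R * M₀ := abs_bgsrTaggedMarginal_sub_mul_le hβ hρ0 hρR Φ hφR t z.1 z.2
        _ ≤ Cout * (t * α / L ^ ((A - 1) / A)) ^ (A ^ 2 / (A - 1)) :=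
            rate_trivial_bound hR hM₀ hc0 hTc
        _ ≤ max Creg Cout * (t * α / L ^ ((A - 1) / A)) ^ (A ^ 2 / (A - 1)) :=
            mul_le_mul_of_nonneg_right (le_max_right _ _) hT0
  -- the `L^∞` norm is the essential supremum
  rw [eLpNorm_exponent_top]
  refine eLpNormEssSup_le_of_ae_bound (key.mono fun z hz => ?_)
  rw [Real.norm_eq_abs]
  exact hz

/-- **The same glue with a general exponent in the `ε`-term** (for the honest recollision
rate). Identical to `bgsr_linearBoltzmannApprox_of_prunedComparison` except that the pruned
comparison (H) may come with ANY exponent of the form `(d - 1)/(q + 1)`, `q ∈ ℕ` (chosen together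
with the constants, after `d, β, A, R`), in place of the printed `(d - 1)/(d + 1)`:
`|f_N^{(1)} - M_β φ_α| ≤ C₁ (γ^A + ε^{(d-1)/(q+1)} exp(C₁ √(log (N+1)) log log (N+1)))` a.e. The
tuning of p. 21 absorbs any positive power of `ε` into `(log log N)^{-A}`
(`rate_epsTerm_mul_le_one` with `n := q`, `log (N+1) ≥ (4 (c₁ + A + C₁')(q + 1))⁴`); a real
exponent `κ > 0` is first weakened to `(d - 1)/(q + 1) ≤ κ` (`ε < 1`). This is the form the
BBGKY-side estimates of §5 deliver once the post-collisional bad set is measured by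
`sphereMeasure_prod_bgsrPostBadSet_le` (`GoodConfigurationsMeasure`), whose rate is a smaller
power of `ε` than the printed (5.9) after the re-tuning of `ā, ε₀, δ` in the proof of Prop. 5.8.
[cite: BodineauGallagherSaintRaymondInvent2016, Thm. 2.2 (2.9) and its proof p. 21] -/
theorem bgsr_linearBoltzmannApprox_of_prunedComparison_pow
    (H : ∀ (_hd : 2 ≤ Fintype.card d) {β : ℝ} (_hβ : 0 < β) {A : ℝ} (_hA : 2 ≤ A) {R : ℝ}
      (_hR : 0 ≤ R),
      ∃ q : ℕ, ∃ κ₁ : ℝ, 0 < κ₁ ∧ ∃ c₁ : ℝ, 0 < c₁ ∧ ∃ c₂ : ℝ, 0 < c₂ ∧ ∃ C₁ : ℝ, ∃ N₁ : ℕ,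
        ∀ N : ℕ, N₁ ≤ N → ∀ ε : ℝ, 0 < ε → ε < 2⁻¹ →
        1 < (N + 1 : ℝ) * ε ^ (Fintype.card d - 1) →
        ∀ ρ₀ : UnitAddTorus d → ℝ, Continuous ρ₀ → (∀ x, 0 ≤ ρ₀ x) → (∀ x, ρ₀ x ≤ R) →
        ∫ x, ρ₀ x = 1 →
        ∀ Φ : HardSphereFlow (Torus.geometry d) ε (N + 1),
        ∀ t : ℝ, 1 < t → ∀ K : ℕ, 1 ≤ K → (K : ℝ) ≤ c₂ * Real.log (Real.log (N + 1)) →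
        ∀ γ : ℝ, 0 < γ → γ ≤ 2⁻¹ →
        t * ((N + 1 : ℝ) * ε ^ (Fintype.card d - 1)) ≤ κ₁ * γ * K →
        (t * ((N + 1 : ℝ) * ε ^ (Fintype.card d - 1))) ^ (A / (A - 1)) ≤ κ₁ * γ * K →
        t * ((N + 1 : ℝ) * ε ^ (Fintype.card d - 1)) ≤
          c₁ * Real.log (Real.log (N + 1)) ^ ((A - 1) / A) →
        ∀ᵐ z : UnitAddTorus d × EuclideanSpace ℝ d,
          |bgsrTaggedMarginal Φ β ρ₀ t z.1 z.2 - maxwellianBeta β z.2 *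
              linearBoltzmannSeries (Torus.geometry d) β ((N + 1 : ℝ) * ε ^ (Fintype.card d - 1))
                (fun x _ => ρ₀ x) t z.1 z.2| ≤
            C₁ * (γ ^ A + ε ^ (((Fintype.card d : ℝ) - 1) / ((q : ℝ) + 1)) *
              Real.exp (C₁ * Real.sqrt (Real.log (N + 1)) * Real.log (Real.log (N + 1))))) :
    bgsr_linearBoltzmannApprox (d := d) := by
  intro hd β hβ A hA R hR
  obtain ⟨q, κ₁, hκ₁, c₁, hc₁, c₂, hc₂, C₁, N₁, hH⟩ := H hd hβ hA hR
  -- the constants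
  have hA0 : 0 < A := by linarith
  have hA1 : 0 < A - 1 := by linarith
  have he0 : 0 < A ^ 2 / (A - 1) := by positivity
  set M₀ : ℝ := (2 * Real.pi * β⁻¹) ^ (-(Module.finrank ℝ (EuclideanSpace ℝ d) : ℝ) / 2)
    with hM₀_def
  have hM₀ : 0 ≤ M₀ := rpow_nonneg (by positivity) _
  set C₁' : ℝ := max C₁ 1 with hC₁'_def
  have hC₁' : 0 ≤ C₁' := le_max_of_le_right zero_le_one
  have hC₁le : C₁ ≤ C₁' := le_max_left _ _
  set c : ℝ := min (min c₁ 1) (κ₁ * c₂ / 4) with hc_def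
  have hc0 : 0 < c := lt_min (lt_min hc₁ one_pos) (by positivity)
  have hc1 : c ≤ 1 := (min_le_left _ _).trans (min_le_right _ _)
  have hcc₁ : c ≤ c₁ := (min_le_left _ _).trans (min_le_left _ _)
  have hcκ : c ≤ κ₁ * c₂ / 4 := min_le_right _ _
  have hr1 : 1 ≤ A / (A - 1) := by
    rw [le_div_iff₀ hA1]
    linarith
  have hcr : c ^ (A / (A - 1)) ≤ c := by
    simpa using rpow_le_rpow_of_exponent_ge hc0 hc1 hr1
  set Creg : ℝ := C₁' * ((2 / (κ₁ * c₂)) ^ A + 1) with hCreg_def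
  set Cout : ℝ := 2 * R * M₀ / c ^ (A ^ 2 / (A - 1)) + 1 with hCout_def
  have hCout : 0 < Cout := by
    have : 0 ≤ 2 * R * M₀ / c ^ (A ^ 2 / (A - 1)) :=
      div_nonneg (by positivity) (rpow_nonneg hc0.le _)
    linarith
  set n : ℕ := Fintype.card d with hn_def
  set ℓ₀ : ℝ := max 1 ((4 * (c₁ + A + C₁') * (q + 1)) ^ 4) with hℓ₀_def
  set L₀ : ℝ := max 1 (2 / c₂) with hL₀_def
  -- largeness of `N`, uniformly in everything else
  have hlog1 : Tendsto (fun N : ℕ => Real.log ((N : ℝ) + 1)) atTop atTop :=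
    tendsto_log_atTop.comp (tendsto_atTop_add_const_right atTop (1 : ℝ)
      tendsto_natCast_atTop_atTop)
  have hlog2 : Tendsto (fun N : ℕ => Real.log (Real.log ((N : ℝ) + 1))) atTop atTop :=
    tendsto_log_atTop.comp hlog1
  obtain ⟨N₂, hN₂⟩ := eventually_atTop.1
    ((hlog1.eventually_ge_atTop ℓ₀).and (hlog2.eventually_ge_atTop L₀))
  refine ⟨max Creg Cout, lt_max_of_lt_right hCout, max N₁ N₂, ?_⟩
  intro N hN ε hε hε2 hα1 ρ₀ hρc hρ0 hρR hρ1 Φ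
  have hNN₁ : N₁ ≤ N := le_of_max_le_left hN
  obtain ⟨hℓ, hL⟩ := hN₂ N (le_of_max_le_right hN)
  set α : ℝ := (N + 1 : ℝ) * ε ^ (n - 1) with hα_def
  set ℓ : ℝ := Real.log (N + 1) with hℓ_def
  set L : ℝ := Real.log ℓ with hL_def
  have hα0 : 0 ≤ α := by positivity
  have hℓ1 : 1 ≤ ℓ := le_trans (le_max_left _ _) hℓ
  have hℓB : (4 * (c₁ + A + C₁') * (q + 1)) ^ 4 ≤ ℓ := le_trans (le_max_right _ _) hℓ
  have hL1 : 1 ≤ L := le_trans (le_max_left _ _) hL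
  have hL0 : 0 < L := by linarith
  have hLc₂ : 2 ≤ c₂ * L := by
    have h := mul_le_mul_of_nonneg_left (le_trans (le_max_right _ _) hL) hc₂.le
    rwa [mul_div_cancel₀ _ hc₂.ne'] at h
  have hq1 : (A - 1) / A ≤ 1 := by
    rw [div_le_one hA0]
    linarith
  have hLq : L ^ ((A - 1) / A) ≤ L :=
    (rpow_le_rpow_of_exponent_le hL1 hq1).trans_eq (rpow_one L)
  have hLq0 : 0 < L ^ ((A - 1) / A) := rpow_pos_of_pos hL0 _
  -- the solution `φ_α` of (1.3): the collision series
  obtain ⟨hφsol, hφR⟩ := isTaggedLinearBoltzmannSolution_linearBoltzmannSeries hβ hα0 hρc hρ0 hρR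
  refine ⟨_, hφsol, fun t ht => ?_⟩
  have ht0 : 0 ≤ t := by linarith
  have hta1 : 1 ≤ t * α := one_le_mul_of_one_le_of_one_le ht.le hα1.le
  have hta0 : 0 ≤ t * α := by positivity
  have hT : (t * α / L ^ ((A - 1) / A)) ^ (A ^ 2 / (A - 1)) =
      (t * α) ^ (A ^ 2 / (A - 1)) / L ^ A := rate_rpow_eq hta0 hL0.le hA
  have hT0 : 0 ≤ (t * α / L ^ ((A - 1) / A)) ^ (A ^ 2 / (A - 1)) :=
    rpow_nonneg (div_nonneg hta0 hLq0.le) _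
  -- the almost-everywhere bound by `max Creg Cout` times the rate
  have key : ∀ᵐ z : UnitAddTorus d × EuclideanSpace ℝ d,
      |bgsrTaggedMarginal Φ β ρ₀ t z.1 z.2 - maxwellianBeta β z.2 *
          linearBoltzmannSeries (Torus.geometry d) β α (fun x _ => ρ₀ x) t z.1 z.2| ≤
        max Creg Cout * (t * α / L ^ ((A - 1) / A)) ^ (A ^ 2 / (A - 1)) := by
    by_cases hreg : t * α ≤ c * L ^ ((A - 1) / A)
    · -- the regime `tα ≤ c L^{(A-1)/A}`: pruned comparison with `K = ⌊c₂ L⌋` blocks and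
      -- `γ = (tα)^{A/(A-1)}/(κ₁ K)`
      obtain ⟨hK1, hKle, hKge⟩ := one_le_floor_and_le hLc₂
      have hK0 : (0 : ℝ) < (⌊c₂ * L⌋₊ : ℕ) := by exact_mod_cast hK1
      set γ : ℝ := t * α / (κ₁ * ⌊c₂ * L⌋₊) with hγ_def
      have hκK : 0 < κ₁ * (⌊c₂ * L⌋₊ : ℕ) := mul_pos hκ₁ hK0
      have htar : t * α ≤ (t * α) ^ (A / (A - 1)) := by
        simpa using rpow_le_rpow_of_exponent_le hta1 hr1
      have htar0 : 0 < (t * α) ^ (A / (A - 1)) := rpow_pos_of_pos (lt_of_lt_of_le one_pos hta1) _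
      set γ : ℝ := (t * α) ^ (A / (A - 1)) / (κ₁ * ⌊c₂ * L⌋₊) with hγ_def
      have hγ0 : 0 < γ := by
        rw [hγ_def]
        exact div_pos htar0 hκK
      have hstep' : (t * α) ^ (A / (A - 1)) ≤ κ₁ * γ * ⌊c₂ * L⌋₊ := by
        rw [hγ_def]
        apply le_of_eq
        calc (t * α) ^ (A / (A - 1))
            = (t * α) ^ (A / (A - 1)) / (κ₁ * (⌊c₂ * L⌋₊ : ℕ)) * (κ₁ * (⌊c₂ * L⌋₊ : ℕ)) :=
              (div_mul_cancel₀ _ hκK.ne').symm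
          _ = κ₁ * ((t * α) ^ (A / (A - 1)) / (κ₁ * (⌊c₂ * L⌋₊ : ℕ))) * (⌊c₂ * L⌋₊ : ℕ) := by
              ring
      have hstep : t * α ≤ κ₁ * γ * ⌊c₂ * L⌋₊ := htar.trans hstep'
      have htac : t * α ≤ c * L := hreg.trans (mul_le_mul_of_nonneg_left hLq hc0.le)
      -- `(tα)^{A/(A-1)} ≤ c^{A/(A-1)} L ≤ c L`
      have htarc : (t * α) ^ (A / (A - 1)) ≤ c * L := by
        have h1 : (t * α) ^ (A / (A - 1)) ≤ (c * L ^ ((A - 1) / A)) ^ (A / (A - 1)) :=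
          rpow_le_rpow hta0 hreg (by positivity)
        have h2 : (c * L ^ ((A - 1) / A)) ^ (A / (A - 1)) = c ^ (A / (A - 1)) * L := by
          rw [mul_rpow hc0.le hLq0.le, ← rpow_mul hL0.le]
          have : (A - 1) / A * (A / (A - 1)) = 1 := by
            field_simp
          rw [this, rpow_one]
        rw [h2] at h1
        exact h1.trans (mul_le_mul_of_nonneg_right hcr hL0.le)
      have hγhalf : γ ≤ 2⁻¹ := by
        rw [hγ_def, div_le_iff₀ hκK]
        have h1 : c * L ≤ κ₁ * c₂ / 4 * L := mul_le_mul_of_nonneg_right hcκ hL0.le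
        have h2 : κ₁ * c₂ / 4 * L = κ₁ / 2 * (c₂ * L / 2) := by ring
        have h3 : κ₁ / 2 * (c₂ * L / 2) ≤ κ₁ / 2 * (⌊c₂ * L⌋₊ : ℕ) :=
          mul_le_mul_of_nonneg_left hKge (by positivity)
        calc (t * α) ^ (A / (A - 1)) ≤ c * L := htarc
          _ ≤ κ₁ / 2 * (⌊c₂ * L⌋₊ : ℕ) := by linarith [h1, h2, h3]
          _ = 2⁻¹ * (κ₁ * (⌊c₂ * L⌋₊ : ℕ)) := by ring
      have hreg' : t * α ≤ c₁ * L ^ ((A - 1) / A) :=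
        hreg.trans (mul_le_mul_of_nonneg_right hcc₁ hLq0.le)
      have hae := hH N hNN₁ ε hε hε2 hα1 ρ₀ hρc hρ0 hρR hρ1 Φ t ht ⌊c₂ * L⌋₊ hK1 hKle γ hγ0
        hγhalf hstep hstep' hreg'
      refine hae.mono fun z hz => hz.trans ?_
      -- the `ε`-term with `C₁'`
      set E : ℝ := ε ^ (((n : ℝ) - 1) / ((q : ℝ) + 1)) * Real.exp (C₁' * Real.sqrt ℓ * L)
        with hE_def
      have hεr0 : 0 ≤ ε ^ (((n : ℝ) - 1) / ((q : ℝ) + 1)) := rpow_nonneg hε.le _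
      have hsL : 0 ≤ Real.sqrt ℓ * L := mul_nonneg (sqrt_nonneg ℓ) hL0.le
      -- `C₁ (γ^A + …C₁…) ≤ C₁' (γ^A + E)`
      have hmono : C₁ * (γ ^ A + ε ^ (((n : ℝ) - 1) / ((q : ℝ) + 1)) *
            Real.exp (C₁ * Real.sqrt ℓ * L)) ≤ C₁' * (γ ^ A + E) := by
        have hexp : Real.exp (C₁ * Real.sqrt ℓ * L) ≤ Real.exp (C₁' * Real.sqrt ℓ * L) := by
          rw [exp_le_exp, mul_assoc, mul_assoc]
          exact mul_le_mul_of_nonneg_right hC₁le hsL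
        have hX0 : 0 ≤ γ ^ A + ε ^ (((n : ℝ) - 1) / ((q : ℝ) + 1)) *
            Real.exp (C₁ * Real.sqrt ℓ * L) :=
          add_nonneg (rpow_nonneg hγ0.le A) (mul_nonneg hεr0 (exp_pos _).le)
        have hXle : γ ^ A + ε ^ (((n : ℝ) - 1) / ((q : ℝ) + 1)) *
            Real.exp (C₁ * Real.sqrt ℓ * L) ≤ γ ^ A + E :=
          add_le_add le_rfl (mul_le_mul_of_nonneg_left hexp hεr0)
        calc C₁ * (γ ^ A + ε ^ (((n : ℝ) - 1) / ((q : ℝ) + 1)) *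
              Real.exp (C₁ * Real.sqrt ℓ * L))
            ≤ C₁' * (γ ^ A + ε ^ (((n : ℝ) - 1) / ((q : ℝ) + 1)) *
              Real.exp (C₁ * Real.sqrt ℓ * L)) := mul_le_mul_of_nonneg_right hC₁le hX0
          _ ≤ C₁' * (γ ^ A + E) := mul_le_mul_of_nonneg_left hXle hC₁'
      -- `E L^A ≤ 1`
      have hEL : E * L ^ A ≤ 1 := by
        have hn1 : 1 ≤ n := le_trans (by norm_num) hd
        have hN1 : (0 : ℝ) < N + 1 := by positivity
        have hεpow : ε ^ (n - 1) = α / Real.exp ℓ := by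
          rw [hℓ_def, Real.exp_log hN1, hα_def]
          field_simp
        have hεr : ε ^ (((n : ℝ) - 1) / ((q : ℝ) + 1)) =
            (α / Real.exp ℓ) ^ (1 / (q + 1 : ℝ)) := by
          rw [← hεpow, ← rpow_natCast ε (n - 1), ← rpow_mul hε.le, Nat.cast_sub hn1,
            Nat.cast_one]
          congr 1
          field_simp
        have hαc₁ : α ≤ c₁ * Real.log ℓ := by
          have h1 : α ≤ t * α := le_mul_of_one_le_left hα0 ht.le
          have h2 : c * L ≤ c₁ * L := mul_le_mul_of_nonneg_right hcc₁ hL0.le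
          linarith [htac]
        have h := rate_epsTerm_mul_le_one (n := q) hc₁ hA0.le hC₁' hℓ1 hℓB hL1 hα0 hαc₁
        rw [hE_def, hεr]
        exact h
      have hbound := rate_regime_bound hA hκ₁ hc₂ hC₁' hL1 hta1 hK0 hKge hγ_def hEL
      calc C₁ * (γ ^ A + ε ^ (((n : ℝ) - 1) / ((q : ℝ) + 1)) *
            Real.exp (C₁ * Real.sqrt ℓ * L))
          ≤ C₁' * (γ ^ A + E) := hmono
        _ ≤ Creg * ((t * α) ^ (A ^ 2 / (A - 1)) / L ^ A) := hbound
        _ = Creg * (t * α / L ^ ((A - 1) / A)) ^ (A ^ 2 / (A - 1)) := by rw [hT]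
        _ ≤ max Creg Cout * (t * α / L ^ ((A - 1) / A)) ^ (A ^ 2 / (A - 1)) :=
            mul_le_mul_of_nonneg_right (le_max_left _ _) hT0
    · -- the complementary regime: the rate exceeds `c^{A²/(A-1)}`
      refine Eventually.of_forall fun z => ?_
      have hlt : c < t * α / L ^ ((A - 1) / A) := by
        rw [lt_div_iff₀ hLq0]
        exact lt_of_not_ge hreg
      have hTc : c ^ (A ^ 2 / (A - 1)) < (t * α / L ^ ((A - 1) / A)) ^ (A ^ 2 / (A - 1)) :=
        rpow_lt_rpow hc0.le hlt he0
      calc |bgsrTaggedMarginal Φ β ρ₀ t z.1 z.2 - maxwellianBeta β z.2 *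
            linearBoltzmannSeries (Torus.geometry d) β α (fun x _ => ρ₀ x) t z.1 z.2|
          ≤ 2 * R * M₀ := abs_bgsrTaggedMarginal_sub_mul_le hβ hρ0 hρR Φ hφR t z.1 z.2
        _ ≤ Cout * (t * α / L ^ ((A - 1) / A)) ^ (A ^ 2 / (A - 1)) :=
            rate_trivial_bound hR hM₀ hc0 hTc
        _ ≤ max Creg Cout * (t * α / L ^ ((A - 1) / A)) ^ (A ^ 2 / (A - 1)) :=
            mul_le_mul_of_nonneg_right (le_max_right _ _) hT0
  -- the `L^∞` norm is the essential supremum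
  rw [eLpNorm_exponent_top]
  refine eLpNormEssSup_le_of_ae_bound (key.mono fun z hz => ?_)
  rw [Real.norm_eq_abs]
  exact hz

end Assembly

end Kinetic

end

end Literature.MathematicalPhysics.KineticTheory
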